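import HarnessLib
import Summits.QuantumFields.YangMills.Theses.BalabanLadder
import Summits.QuantumFields.YangMills.Theorems.BalabanLadderUVSeamRecStubTransport
import Summits.QuantumFields.YangMills.Theorems.BalabanLadderUVSeamRecUnitTransfer
import Summits.QuantumFields.YangMills.Theorems.BalabanLadderUVSeamRecCeilingsResponseMomentsUnit
import Summits.QuantumFields.YangMills.Theorems.BalabanLadderUVSeamRecResponseMomentsRecentring
import Summits.QuantumFields.YangMills.Theorems.LangevinControlUVOSLegsFromFemtoAndGapStubAssemblyPlaneStrings
import Literature.MathematicalPhysics.QuantumLattice.RepLieAlgebraUnitary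
/-! # LINE «slack-coldwall» (one-sided cold-wall ceiling with an `R⁻⁴` allowance) for crux `UVSeamRec` (stmt-QuantumFields-20043) — ideator ym-idea-10 g3 (lens RESCUER), 2026-08-28

A RESCUED skeleton (crux workfile, not a registry write; the owner's pen decides; registry of record stays v5(α) `TemperedResponse`).

CORPSE AND LOCATED ORGAN.  The g2 line `extremal_coldwall` (critic idea-crit-9 VERDICT #14: PASS-WITH-PRICE, «cleanest cut of the (RM)-currency family»)
rests its whole deterministic side on an EXACT sign, (CWX) `kerE^η(plane) ≤ kerE^𝟙(plane)` for EVERY exterior `η`.  The critic's own attack and this seat's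
instrument row 1(f) locate its one live danger precisely (organ K7): exteriors that are NOT pure gauge but whose classical minimiser is FLAT AT THE CENTRE —
there the comparison with the cold wall is PURELY QUANTUM (diamagnetic suppression of a charged mode's propagator diagonal, Kato's inequality, runs AGAINST
the sign; paramagnetic spin-one dominance and `⟨F²F²⟩_conn ≥ 0` run FOR it), of undecided sign, and no Griffiths/FKG-type inequality exists for non-abelian
lattice gauge theory to settle it.  Everything ELSE in `extremal_coldwall` is robust: the glue never needs the sign exactly.

THE VARIATION OF EXACTLY THAT ORGAN — (SCW) «SLACK COLD-WALL CEILING»: `∃ κ ≥ 0`, on the window, for EVERY exterior `η`,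
`kerE^η_{β,Λ}(plane q x) ≤ kerE^𝟙_{β,Λ}(plane q x) + κ/R⁴` (`Λ` the Dirichlet cube of side `2R+3` centred at `x`).  A ONE-SIDED `∀η` size law at the rate `R⁻⁴`:
* it is the statement JUST OUTSIDE the refuted class: the two-sided `∀η` law at rate `d⁻⁴` (FBL6 / sup_ζ / UCR) is killed by COHERENT CLASSICAL FLUX
  PENETRATION `≍ d⁻²` (`not_fbl6_of_classicalPlanePenetration_inv_sq`, LEAD #50) — but penetrating flux DISORDERS the centre, i.e. moves `kerE^η(plane)` DOWN,
  the direction (SCW) leaves free; no exterior is known, classically or at one loop, that ORDERS the centre beyond the cold wall by more than `O(g²(R)·Φ²·R⁻⁵)`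
  (gauge invariance forces a distant background to act on `⟨tr F²(x)⟩` through dimension-4 operators: `⟨trF²(x) trF²(y)⟩_conn ≍ |x−y|⁻⁸` integrated over a
  boundary layer `≍ R³` gives `R⁻⁵`), so the allowance `κ/R⁴` has a full power of `R` to spare on the danger family and is AF-consistent (no `β` in it);
* it is EXACTLY the weakest allowance the glue tolerates (`R⁴/C₁ × 2κ/R⁴ = 2κ/C₁` per site: `B ↦ B + 2κ/C₁`; an allowance `R⁻³` would cost `e^{κR·#T/C₁}`) —
  typing checklist 4c(iv): `∃ κ`, no hand-picked constant;
* (CWX) is its `κ = 0` case (`slackColdWall_of_coldWallExtremal`, sorry-free below): every piece of (CWX)'s evidence (lattice GFF: exact; pure-gauge walls: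
  equality, `extremal_coldwall_rung`; 2-D SU(2): 66-row character check; U(1)/Villain: Driver 1987 Prop 8.1) is evidence for (SCW), and a refutation of
  (CWX) on the centre-flat family at size `o(R⁻⁴)` does NOT touch (SCW).
PRICE PAID FOR THE SLACK (stated, not hidden): (CWX) had a structural proof path (correlation inequality, all `β`); (SCW) is an asymptotic `∀η` statement
whose natural proof is perturbative-around-each-wall PLUS a monotone/roughening argument for rough walls («a rough wall cannot order the centre») — the
first `∀η` statement in this cone that the flux-penetration witnesses cannot reach.

MEASURE SIDE UNCHANGED: `stub_defectMoments` (XM) — ONE-SIDED joint exponential moments of the signed cold-wall defect in RESPONSE units, byte-identical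
to `extremal_coldwall` (one stub text, two lines); `stub_floorsEngine` byte-identical to v5(α)/v7c/v8c/v8d (NT desk 19353).  No reference value is
posited (`pRef` = torus mean on the canonical torus `L†(β)`, DERIVED), no carrier, no rarity clause, no bare-β normalisation: K2/K4/K5/K6 have no organ.

THEOREMS (kernel-checked): `slackColdWall_of_coldWallExtremal` ((CWX) ⇒ (SCW), `κ = 0`); `absMoments_of_slack` ((SCW) ∧ (XM) ⇒ the cold-wall-centred
ABSOLUTE joint moment bound with `B ↦ B + 2κ/C₁`: pointwise `|kerE^U − kerE^𝟙| ≤ (kerE^𝟙 − kerE^U) + 2κ/R⁴`, `torusE_mono`, `torusE_const_mul'`);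
`coldWall_pin_abs` (one-site absolute moment ⇒ `|kerE^𝟙_{β,R}(plane q x) − pRef| ≤ C₁(e^B − 1)/R⁴`, the Dirichlet finite-size law as a COROLLARY — torus
DLR `torusE_plane_eq_torusE_kerE` + translation invariance); `responseMomentsOdd6SU2_of_absMoments` (⇒ the registered (RM) body, `a := uRec`, `c := 1`,
`B ↦ B + (e^B − 1)`, via `ResponsePinning.torusE_exp_sum_response_recentre`); `stub_responseMomentsOdd6` (registered v5(α) text VERBATIM), `stub_ceilings`,
`stub_transport`, `UVSeamRec_of` (the crux BY NAME).  Stubs (sorries) = {`stub_slackColdWall`, `stub_defectMoments`, `stub_floorsEngine`}.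
TRUTH-IN-LABELLING (K1): measure stubs WITHOUT the idle `UV →`; `UVSeamRec_of` keeps it, unconsumed, visibly (UV export is ym-idea-9's desk).
bears_on: LADDER-YM rung R2d · stmt-QuantumFields-20043 · route-QuantumFields-BalabanLadder.

INSTRUMENT ROW (refutes SCW by SCALING, one engine run): Dirichlet cubes `R = 1,2,3,4` at β_std ∈ {2.3, 2.5, 2.7}; walls (a) cold, (f) centre-flat
non-pure-gauge (`±Φ` abelian flux on two adjacent boundary rows of one face, net centre flux 0, `Φ ∈ {π/8, π/4, π/2}`), (g) «squeezed» walls (boundary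
plaquettes cold AND the first interior shell's links pinned by a Z₂-centre twist pattern); statistic `E(R) := R⁴·max_η (⟨P_c⟩_η − ⟨P_c⟩_cold)₊`: (SCW) predicts
`E(R)` BOUNDED (indeed `→ 0` like `R⁻¹/β`); growth of `E(R)` in `R` kills the line; (CWX) predicts `E ≡ 0` — the same run grades both lines.
ANALYTIC ROW: the one-loop coefficient `c₁(η)` in `kerE^η − kerE^𝟙 = c₁(η)/β + O(β⁻²)` for the family (f) as a lattice-propagator computation in a half-space
background: `sup_Φ c₁ · R⁴ → ∞` in `R` kills (SCW); `c₁ > 0` at some `R` kills (CWX) but not (SCW).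

HONEST FRAMING: a re-cut of OPEN conditional content plus kernel-checked glue; (SCW) is a bet stated as a stub with its evidence; nothing of E0′, NT or a
gap is claimed; not Clay; no summit, leg or spine crux is proved by a line.
-/

namespace Summit.QuantumFields.YangMills.Cruxes.UVSeamRec.SlackColdWall

open Literature.MathematicalPhysics.QuantumFieldTheory
open Summit.QuantumFields.YangMills.Cruxes.OSLegsFromFemtoAndGap.DlrCollarTransfer
open Filter Topology
open scoped SchwartzMap
open Literature.MathematicalPhysics.QuantumLattice (thetaTest LGConfig fundamentalLatticeRep)
open Summit.QuantumFields.YangMills.Cruxes.UVSeamRec.ResponsePinning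
  (torusE_exp_sum_response_recentre torusE_abs_sub_le_of_expMoment torusE_plane_eq_torusE_kerE torusE_add' torusE_const
   abs_torusE_sub_le_of_forall torusE_mono torusE_const_mul')
open Summit.QuantumFields.YangMills.Cruxes.UVSeamRec.TemperedResponse (continuous_kerE_plane abs_kerE_plane_le)
open Summit.QuantumFields.YangMills.Theorems.OSLegsFromFemtoAndGap (torusE_plane_eq_wilsonTorusMean)

/-- The FUNDAMENTAL (defining) lattice representation of `SU(2)` (as v4-F/v5(α)). -/
abbrev rF : LatticeRep (Matrix.specialUnitaryGroup (Fin 2) ℂ) :=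
  Literature.MathematicalPhysics.QuantumLattice.fundamentalLatticeRep 2

/-- the unit of record (abbreviation used only inside this skeleton). -/
noncomputable abbrev uRec : ℝ → ℝ := fun β => Real.exp (Summit.QuantumFields.YangMills.Theorems.FemtoTransferGap.sizeLog β 1)

/-- The canonical admissible torus half-side at coupling `β` for the window `R·uRec β ≤ ℓ₁`: `L†(β) = 4⌈ℓ₁/uRec β⌉ + 8` (so `4R + 8 ≤ L†(β)` for every
admissible radius `R`). -/
noncomputable def Ldag (ℓ₁ : ℝ) (β : ℝ) : ℕ := 4 * ⌈ℓ₁ / Transport.uRec β⌉₊ + 8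

/-- The DERIVED reference value: the torus plaquette mean on the canonical admissible torus. -/
noncomputable def pRef (ℓ₁ : ℝ) (q : Fin 4 × Fin 4) (β : ℝ) : ℝ :=
  letI : MeasurableSpace (Matrix.specialUnitaryGroup (Fin 2) ℂ) := borel _
  haveI : BorelSpace (Matrix.specialUnitaryGroup (Fin 2) ℂ) := ⟨rfl⟩
  torusE (Matrix.specialUnitaryGroup (Fin 2) ℂ) rF β (Ldag ℓ₁ β) (plane (Matrix.specialUnitaryGroup (Fin 2) ℂ) rF q 0)

theorem uRec_pos (β : ℝ) : 0 < Transport.uRec β := Real.exp_pos _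

theorem le_Ldag {ℓ₁ β : ℝ} {R : ℕ} (hRa : (R : ℝ) * Transport.uRec β ≤ ℓ₁) : 4 * R + 8 ≤ Ldag ℓ₁ β := by
  have h1 : (R : ℝ) ≤ ℓ₁ / Transport.uRec β := (le_div_iff₀ (uRec_pos β)).2 hRa
  have h2 : (R : ℝ) ≤ (⌈ℓ₁ / Transport.uRec β⌉₊ : ℕ) := h1.trans (Nat.le_ceil _)
  have h3 : R ≤ ⌈ℓ₁ / Transport.uRec β⌉₊ := by exact_mod_cast h2
  unfold Ldag
  omega

/-- D0 (iso-transport) — PROVED (`Transport.stub_transport_proved`, p412513); text = v5(α) verbatim. -/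
theorem stub_transport :
    (letI : MeasurableSpace (Matrix.specialUnitaryGroup (Fin 2) ℂ) := borel _
     haveI : BorelSpace (Matrix.specialUnitaryGroup (Fin 2) ℂ) := ⟨rfl⟩
     ∃ r₂ : LatticeRep (Matrix.specialUnitaryGroup (Fin 2) ℂ),
       LowerBounds (Matrix.specialUnitaryGroup (Fin 2) ℂ) r₂ uRec ∧ MomentBounds6 (Matrix.specialUnitaryGroup (Fin 2) ℂ) r₂ uRec) →
    ∀ (G : Type) [Group G] [TopologicalSpace G] [IsTopologicalGroup G] [CompactSpace G],
      IsCompactSimpleLieGroup G → Nonempty (G ≃ₜ* Matrix.specialUnitaryGroup (Fin 2) ℂ) →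
      letI : MeasurableSpace G := borel G; haveI : BorelSpace G := ⟨rfl⟩;
      ∃ r : LatticeRep G, LowerBounds G r uRec ∧ MomentBounds6 G r uRec := by
  exact Summit.QuantumFields.YangMills.Cruxes.UVSeamRec.Transport.stub_transport_proved

/-- STUB (SCW) «SLACK COLD-WALL CEILING» (L/XL; the VARIED ORGAN — a ONE-SIDED `∀η` size law at the rate `R⁻⁴`): an allowance `κ ≥ 0` and thresholds
`β₀`, `ℓ₀ > 0` such that for `β ≥ β₀`, `1 ≤ R`, `R·uRec β ≤ ℓ₀`, every plane `q`, site `x` and EVERY exterior `η`, the expected centre plaquette of the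
Dirichlet cube of side `2R+3` around `x` exceeds its cold-wall value by at most `κ/R⁴`: `kerE^η(plane q x) ≤ kerE^𝟙(plane q x) + κ/R⁴`.  (CWX) of
`extremal_coldwall` is the case `κ = 0` (`slackColdWall_of_coldWallExtremal`).  Evidence: everything supporting (CWX) (lattice GFF exact with response
`≥ 0`; pure-gauge exteriors: equality; 2-D SU(2) character check; U(1)/Villain Driver 1987 Prop 8.1; cold wall critical by `η ↦ η̄` with a negative
semi-definite one-loop second variation) PLUS the power count on (CWX)'s one live danger: for centre-flat non-pure-gauge walls the comparison is purely
quantum and gauge invariance routes a distant background through dimension-4 operators, `⟨trF²(x)trF²(y)⟩_conn ≍ |x−y|⁻⁸` over a layer `≍ R³` ⇒ excess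
`O(g²(R)Φ²R⁻⁵) = o(R⁻⁴)`; coherent penetrating flux (the witness `not_fbl6_of_classicalPlanePenetration_inv_sq` that kills every TWO-sided `∀η` law) moves
`kerE^η(plane)` DOWN, the free direction.  No rarity, no reference value, no carrier, no `β` in the allowance (AF-consistent): K2/K4/K5/K6 have no organ;
`∃ κ` is the weakest allowance the glue tolerates (4c(iv)).  Why it might fail: a wall family («squeezed» exteriors: a Z₂-centre pattern or a
charged-mode-gapping background near the boundary) that suppresses the centre plaquette's QUANTUM fluctuations below their cold-wall level by `≫ R⁻⁴`, i.e. a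
diamagnetic effect decaying slower than `R⁻⁴` — not excluded by any known inequality for non-abelian theories; and for ROUGH walls the bound needs «a rough
wall cannot order the centre», unproved.  INSTRUMENT: `E(R) := R⁴·max_η(⟨P_c⟩_η − ⟨P_c⟩_cold)₊` over walls (a) cold, (f) centre-flat `±Φ` two-row flux,
(g) Z₂-squeezed, `R = 1..4`, β_std 2.3–2.7: growth of `E(R)` in `R` kills the line (boundedness, indeed decay `≍ R⁻¹`, predicted). -/
theorem stub_slackColdWall :
    ∃ (κ β₀ ℓ₀ : ℝ), 0 ≤ κ ∧ 0 < ℓ₀ ∧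
      ∀ β : ℝ, β₀ ≤ β → ∀ R : ℕ, 1 ≤ R → (R : ℝ) * Transport.uRec β ≤ ℓ₀ →
      ∀ (q : Fin 4 × Fin 4) (x : Fin 4 → ℤ), q.1 < q.2 → ∀ η : LGConfig 4 (Matrix.specialUnitaryGroup (Fin 2) ℂ),
        kerE (Matrix.specialUnitaryGroup (Fin 2) ℂ) (fundamentalLatticeRep 2) β (fun k => x k - (R + 1)) (2 * R + 3) η
            (plane (Matrix.specialUnitaryGroup (Fin 2) ℂ) (fundamentalLatticeRep 2) q x) ≤
          kerE (Matrix.specialUnitaryGroup (Fin 2) ℂ) (fundamentalLatticeRep 2) β (fun k => x k - (R + 1)) (2 * R + 3) 1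
            (plane (Matrix.specialUnitaryGroup (Fin 2) ℂ) (fundamentalLatticeRep 2) q x) + κ / (R : ℝ) ^ 4 := by
  sorry

/-- RUNG (sorry-free): (CWX) — the exact sign of `extremal_coldwall` — is the `κ = 0` case of (SCW).  So every proof or refutation transfers one way:
(CWX) proved ⇒ (SCW); (SCW) refuted ⇒ (CWX) refuted; a refutation of (CWX) of size `o(R⁻⁴)` leaves (SCW) standing. -/
theorem slackColdWall_of_coldWallExtremal
    (hCW : ∃ (β₀ ℓ₀ : ℝ), 0 < ℓ₀ ∧
      ∀ β : ℝ, β₀ ≤ β → ∀ R : ℕ, 1 ≤ R → (R : ℝ) * Transport.uRec β ≤ ℓ₀ →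
      ∀ (q : Fin 4 × Fin 4) (x : Fin 4 → ℤ), q.1 < q.2 → ∀ η : LGConfig 4 (Matrix.specialUnitaryGroup (Fin 2) ℂ),
        kerE (Matrix.specialUnitaryGroup (Fin 2) ℂ) (fundamentalLatticeRep 2) β (fun k => x k - (R + 1)) (2 * R + 3) η
            (plane (Matrix.specialUnitaryGroup (Fin 2) ℂ) (fundamentalLatticeRep 2) q x) ≤
          kerE (Matrix.specialUnitaryGroup (Fin 2) ℂ) (fundamentalLatticeRep 2) β (fun k => x k - (R + 1)) (2 * R + 3) 1
            (plane (Matrix.specialUnitaryGroup (Fin 2) ℂ) (fundamentalLatticeRep 2) q x)) :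
    ∃ (κ β₀ ℓ₀ : ℝ), 0 ≤ κ ∧ 0 < ℓ₀ ∧
      ∀ β : ℝ, β₀ ≤ β → ∀ R : ℕ, 1 ≤ R → (R : ℝ) * Transport.uRec β ≤ ℓ₀ →
      ∀ (q : Fin 4 × Fin 4) (x : Fin 4 → ℤ), q.1 < q.2 → ∀ η : LGConfig 4 (Matrix.specialUnitaryGroup (Fin 2) ℂ),
        kerE (Matrix.specialUnitaryGroup (Fin 2) ℂ) (fundamentalLatticeRep 2) β (fun k => x k - (R + 1)) (2 * R + 3) η
            (plane (Matrix.specialUnitaryGroup (Fin 2) ℂ) (fundamentalLatticeRep 2) q x) ≤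
          kerE (Matrix.specialUnitaryGroup (Fin 2) ℂ) (fundamentalLatticeRep 2) β (fun k => x k - (R + 1)) (2 * R + 3) 1
            (plane (Matrix.specialUnitaryGroup (Fin 2) ℂ) (fundamentalLatticeRep 2) q x) + κ / (R : ℝ) ^ 4 := by
  obtain ⟨β₀, ℓ₀, hℓ₀, h⟩ := hCW
  refine ⟨0, β₀, ℓ₀, le_rfl, hℓ₀, fun β hβ R hR hRa q x hq η => ?_⟩
  rw [zero_div, add_zero]
  exact h β hβ R hR hRa q x hq η

/-- STUB (XM) «ONE-SIDED JOINT EXPONENTIAL MOMENTS OF THE COLD-WALL DEFECT, in response units» (XL; HARDEST; the whole measure-side size content of the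
line; BYTE-IDENTICAL to `extremal_coldwall`'s (XM) — one stub text, two lines): constants `C₁ > 0`, `ℓ₁ > 0`, `B`, `β₁` such that for `β ≥ β₁`, on every odd torus `2L+1` with `4R+8 ≤ L`, every cyclically `2R+4`-separated family
on the window `R·uRec β ≤ ℓ₁` and every sub-family `T`:
`⟨exp(Σ_{i∈T} (R⁴/C₁)·(kerE^𝟙_i(plane) − kerE^{U}_i(plane)))⟩_{2L+1,β} ≤ exp(B·#T)`.  NO absolute value (exteriors ordering the centre more than the cold
wall — allowed up to `κ/R⁴` by (SCW) — are free), NO reference value, NO carrier, NO rarity clause: the torus state is asked directly for the extensive law of the physically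
signed defect, in RESPONSE units (AF-consistent: `(R⁴/C₁)·defect ≍ g²(R)/C₁ ≤ g²(ℓ₁)/C₁`, K6 cannot bite).  Implied by (RM) referenced to the cold wall;
with (SCW) it implies (RM) (glue below) AND the two-sided Dirichlet finite-size law `|kerE^𝟙_{β,R} − ⟨P⟩| ≤ C₁(e^{B+2κ/C₁}−1)/R⁴` (`coldWall_pin_abs`:
(DR)'s content is a corollary, not a stub).  Gaussian calibration: defect = `(R⁴/C₁)×`(harmonic centre flux)², joint exponential moments = seam-s2 `GaussianCalibrationLaw`
(PROVED for the GFF; operator-norm constant).  Semiclassics: torons give defect `≲ (R/L)⁴·O(1)`; instantons of size `ρ ≥ R` give defect `≍ R⁴ρ⁴/(ρ²+R²)⁴/C₁ ≤ 1/C₁`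
— bounded pointwise contribution.  Why it might fail: it is a UV-stability statement of E0′ type for a centre-plaquette statistic uniform in the torus
size (the extensive joint law over separated cubes is the multiscale-cluster-expansion content of every (RM)-currency line; LEAD g10: no
finite-dimensional special case); a heavy upper tail of the defect (exteriors disordering the centre by `O(1)` with probability not exponentially small in
`R⁴/C₁`) would make the exponential moment infinite.  INSTRUMENT: torus β_std 2.5–2.85, `L = 24–32`, `R = 2..5`: histogram of `(R⁴/C₁)(kerE^𝟙 − kerE^{U})`
over sampled exteriors `U` (kernel means by inner MC), single-cube `log⟨exp⟩` vs `C₁`, and the pair excess for two cubes at separation `2R+4`. -/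
theorem stub_defectMoments :
    letI : MeasurableSpace (Matrix.specialUnitaryGroup (Fin 2) ℂ) := borel _
    haveI : BorelSpace (Matrix.specialUnitaryGroup (Fin 2) ℂ) := ⟨rfl⟩
    ∃ (C₁ B β₁ ℓ₁ : ℝ), 0 < C₁ ∧ 0 < ℓ₁ ∧
      ∀ β : ℝ, β₁ ≤ β → ∀ (L n : ℕ) (q : Fin n → Fin 4 × Fin 4) (x : Fin n → (Fin 4 → ℤ)) (R : ℕ),
      (∀ i, (q i).1 < (q i).2) → 1 ≤ R → (R : ℝ) * Transport.uRec β ≤ ℓ₁ → 4 * R + 8 ≤ L →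
      (∀ i j : Fin n, i ≠ j → ∃ k : Fin 4,
        (2 * (R : ℤ) + 4) ≤ |((((x i k - x j k : ℤ) : ZMod (2 * L + 1))).valMinAbs : ℤ)|) →
      ∀ T : Finset (Fin n),
        torusE (Matrix.specialUnitaryGroup (Fin 2) ℂ) (fundamentalLatticeRep 2) β L
          (fun U => Real.exp (∑ i ∈ T, (R : ℝ) ^ 4 / C₁ *
            (kerE (Matrix.specialUnitaryGroup (Fin 2) ℂ) (fundamentalLatticeRep 2) β (fun k => x i k - (R + 1)) (2 * R + 3) 1
                (plane (Matrix.specialUnitaryGroup (Fin 2) ℂ) (fundamentalLatticeRep 2) (q i) (x i)) -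
              kerE (Matrix.specialUnitaryGroup (Fin 2) ℂ) (fundamentalLatticeRep 2) β (fun k => x i k - (R + 1)) (2 * R + 3) U
                (plane (Matrix.specialUnitaryGroup (Fin 2) ℂ) (fundamentalLatticeRep 2) (q i) (x i))))) ≤ Real.exp (B * T.card) := by
  sorry

/-- **PINNING FROM THE ONE-SITE ABSOLUTE MOMENT** (proved): the ONE-SITE cold-wall-centred absolute exponential moment at `(β, R)` on the canonical
torus `L†(β)` pins the cold-wall kernel mean within `C₁(e^B − 1)/R⁴` of the DERIVED reference value `pRef ℓ₁ q β` — the Dirichlet finite-size law as a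
corollary (one-site moment bound `ResponsePinning.torusE_abs_sub_le_of_expMoment`, torus DLR `torusE_plane_eq_torusE_kerE`, translation invariance
`torusE_plane_eq_wilsonTorusMean`). -/
theorem coldWall_pin_abs {C₁ B ℓ₁ β : ℝ} (hC₁ : 0 < C₁) {R : ℕ} (hR : 1 ≤ R) (hRa : (R : ℝ) * Transport.uRec β ≤ ℓ₁)
    (q : Fin 4 × Fin 4) (x : Fin 4 → ℤ)
    (hX1 : letI : MeasurableSpace (Matrix.specialUnitaryGroup (Fin 2) ℂ) := borel _
      haveI : BorelSpace (Matrix.specialUnitaryGroup (Fin 2) ℂ) := ⟨rfl⟩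
      torusE (Matrix.specialUnitaryGroup (Fin 2) ℂ) (fundamentalLatticeRep 2) β (Ldag ℓ₁ β)
          (fun U => Real.exp ((R : ℝ) ^ 4 / C₁ *
            |kerE (Matrix.specialUnitaryGroup (Fin 2) ℂ) (fundamentalLatticeRep 2) β (fun k => x k - (R + 1)) (2 * R + 3) U
                (plane (Matrix.specialUnitaryGroup (Fin 2) ℂ) (fundamentalLatticeRep 2) q x) -
              kerE (Matrix.specialUnitaryGroup (Fin 2) ℂ) (fundamentalLatticeRep 2) β (fun k => x k - (R + 1)) (2 * R + 3) 1
                (plane (Matrix.specialUnitaryGroup (Fin 2) ℂ) (fundamentalLatticeRep 2) q x)|)) ≤ Real.exp B) :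
    |kerE (Matrix.specialUnitaryGroup (Fin 2) ℂ) (fundamentalLatticeRep 2) β (fun k => x k - (R + 1)) (2 * R + 3) 1
        (plane (Matrix.specialUnitaryGroup (Fin 2) ℂ) (fundamentalLatticeRep 2) q x) - pRef ℓ₁ q β| ≤ C₁ * (Real.exp B - 1) / (R : ℝ) ^ 4 := by
  letI : MeasurableSpace (Matrix.specialUnitaryGroup (Fin 2) ℂ) := borel _
  haveI : BorelSpace (Matrix.specialUnitaryGroup (Fin 2) ℂ) := ⟨rfl⟩
  set L : ℕ := Ldag ℓ₁ β with hLdef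
  have hL : 4 * R + 8 ≤ L := le_Ldag hRa
  set K1 : ℝ := kerE (Matrix.specialUnitaryGroup (Fin 2) ℂ) (fundamentalLatticeRep 2) β (fun k => x k - (R + 1)) (2 * R + 3) 1
        (plane (Matrix.specialUnitaryGroup (Fin 2) ℂ) (fundamentalLatticeRep 2) q x) with hK1
  set k : LGConfig 4 (Matrix.specialUnitaryGroup (Fin 2) ℂ) → ℝ := fun U =>
    kerE (Matrix.specialUnitaryGroup (Fin 2) ℂ) (fundamentalLatticeRep 2) β (fun k => x k - (R + 1)) (2 * R + 3) U
        (plane (Matrix.specialUnitaryGroup (Fin 2) ℂ) (fundamentalLatticeRep 2) q x) with hk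
  have hkc : Continuous k := continuous_kerE_plane rF β _ _ q x
  have hR0 : (0 : ℝ) < R := by exact_mod_cast (show 0 < R by omega)
  have hlam : 0 < (R : ℝ) ^ 4 / C₁ := by positivity
  have h1 : torusE (Matrix.specialUnitaryGroup (Fin 2) ℂ) rF β L (fun U => Real.exp ((R : ℝ) ^ 4 / C₁ * |k U - K1|)) ≤ Real.exp B := hX1
  have h2 : torusE (Matrix.specialUnitaryGroup (Fin 2) ℂ) rF β L (fun U => |k U - K1|) ≤ (Real.exp B - 1) / ((R : ℝ) ^ 4 / C₁) :=
    torusE_abs_sub_le_of_expMoment rF β L hkc hlam (p := K1) (B := B) h1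
  have h3 : (Real.exp B - 1) / ((R : ℝ) ^ 4 / C₁) = C₁ * (Real.exp B - 1) / (R : ℝ) ^ 4 := by
    field_simp
  rw [h3] at h2
  -- the derived reference value is the torus mean of `k` (DLR + translation invariance)
  have hp : pRef ℓ₁ q β = torusE (Matrix.specialUnitaryGroup (Fin 2) ℂ) rF β L k := by
    show torusE (Matrix.specialUnitaryGroup (Fin 2) ℂ) rF β L (plane (Matrix.specialUnitaryGroup (Fin 2) ℂ) rF q 0) = _
    rw [torusE_plane_eq_wilsonTorusMean rF β L q 0, ← torusE_plane_eq_wilsonTorusMean rF β L q x,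
      torusE_plane_eq_torusE_kerE rF β q x R L (by omega)]
  have h4 : torusE (Matrix.specialUnitaryGroup (Fin 2) ℂ) rF β L k - K1 =
      torusE (Matrix.specialUnitaryGroup (Fin 2) ℂ) rF β L (fun U => k U - K1) := by
    rw [show (fun U => k U - K1) = (fun U => k U + -K1) from funext fun _ => sub_eq_add_neg _ _,
      torusE_add' rF β L hkc continuous_const, torusE_const]
    ring
  rw [abs_sub_comm, hp, h4]
  unfold torusE at h2 ⊢
  exact (MeasureTheory.abs_integral_le_integral_abs).trans h2

/-- **THE SLACK GLUE** (proved): (SCW) ∧ (XM) ⇒ the cold-wall-centred ABSOLUTE joint exponential moment bound, constants `(C₁, B + 2κ/C₁, max β₀ β₁,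
min ℓ₀ ℓ₁)`.  Mechanism: pointwise `|kerE^U − kerE^𝟙| ≤ (kerE^𝟙 − kerE^U) + 2κ/R⁴` from the one-sided allowance, so
`(R⁴/C₁)|kerE^U_i − kerE^𝟙_i| ≤ (R⁴/C₁)(kerE^𝟙_i − kerE^U_i) + 2κ/C₁`; sum over `T`, exponentiate, `torusE_mono`, `torusE_const_mul'`. -/
theorem absMoments_of_slack
    (hSCW : ∃ (κ β₀ ℓ₀ : ℝ), 0 ≤ κ ∧ 0 < ℓ₀ ∧
      ∀ β : ℝ, β₀ ≤ β → ∀ R : ℕ, 1 ≤ R → (R : ℝ) * Transport.uRec β ≤ ℓ₀ →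
      ∀ (q : Fin 4 × Fin 4) (x : Fin 4 → ℤ), q.1 < q.2 → ∀ η : LGConfig 4 (Matrix.specialUnitaryGroup (Fin 2) ℂ),
        kerE (Matrix.specialUnitaryGroup (Fin 2) ℂ) (fundamentalLatticeRep 2) β (fun k => x k - (R + 1)) (2 * R + 3) η
            (plane (Matrix.specialUnitaryGroup (Fin 2) ℂ) (fundamentalLatticeRep 2) q x) ≤
          kerE (Matrix.specialUnitaryGroup (Fin 2) ℂ) (fundamentalLatticeRep 2) β (fun k => x k - (R + 1)) (2 * R + 3) 1
            (plane (Matrix.specialUnitaryGroup (Fin 2) ℂ) (fundamentalLatticeRep 2) q x) + κ / (R : ℝ) ^ 4)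
    (hXM : letI : MeasurableSpace (Matrix.specialUnitaryGroup (Fin 2) ℂ) := borel _
      haveI : BorelSpace (Matrix.specialUnitaryGroup (Fin 2) ℂ) := ⟨rfl⟩
      ∃ (C₁ B β₁ ℓ₁ : ℝ), 0 < C₁ ∧ 0 < ℓ₁ ∧
      ∀ β : ℝ, β₁ ≤ β → ∀ (L n : ℕ) (q : Fin n → Fin 4 × Fin 4) (x : Fin n → (Fin 4 → ℤ)) (R : ℕ),
      (∀ i, (q i).1 < (q i).2) → 1 ≤ R → (R : ℝ) * Transport.uRec β ≤ ℓ₁ → 4 * R + 8 ≤ L →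
      (∀ i j : Fin n, i ≠ j → ∃ k : Fin 4,
        (2 * (R : ℤ) + 4) ≤ |((((x i k - x j k : ℤ) : ZMod (2 * L + 1))).valMinAbs : ℤ)|) →
      ∀ T : Finset (Fin n),
        torusE (Matrix.specialUnitaryGroup (Fin 2) ℂ) (fundamentalLatticeRep 2) β L
          (fun U => Real.exp (∑ i ∈ T, (R : ℝ) ^ 4 / C₁ *
            (kerE (Matrix.specialUnitaryGroup (Fin 2) ℂ) (fundamentalLatticeRep 2) β (fun k => x i k - (R + 1)) (2 * R + 3) 1
                (plane (Matrix.specialUnitaryGroup (Fin 2) ℂ) (fundamentalLatticeRep 2) (q i) (x i)) -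
              kerE (Matrix.specialUnitaryGroup (Fin 2) ℂ) (fundamentalLatticeRep 2) β (fun k => x i k - (R + 1)) (2 * R + 3) U
                (plane (Matrix.specialUnitaryGroup (Fin 2) ℂ) (fundamentalLatticeRep 2) (q i) (x i))))) ≤ Real.exp (B * T.card)) :
    letI : MeasurableSpace (Matrix.specialUnitaryGroup (Fin 2) ℂ) := borel _
    haveI : BorelSpace (Matrix.specialUnitaryGroup (Fin 2) ℂ) := ⟨rfl⟩
    ∃ (C₁ B β₁ ℓ₁ : ℝ), 0 < C₁ ∧ 0 < ℓ₁ ∧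
      ∀ β : ℝ, β₁ ≤ β → ∀ (L n : ℕ) (q : Fin n → Fin 4 × Fin 4) (x : Fin n → (Fin 4 → ℤ)) (R : ℕ),
      (∀ i, (q i).1 < (q i).2) → 1 ≤ R → (R : ℝ) * Transport.uRec β ≤ ℓ₁ → 4 * R + 8 ≤ L →
      (∀ i j : Fin n, i ≠ j → ∃ k : Fin 4,
        (2 * (R : ℤ) + 4) ≤ |((((x i k - x j k : ℤ) : ZMod (2 * L + 1))).valMinAbs : ℤ)|) →
      ∀ T : Finset (Fin n),
        torusE (Matrix.specialUnitaryGroup (Fin 2) ℂ) (fundamentalLatticeRep 2) β L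
          (fun U => Real.exp (∑ i ∈ T, (R : ℝ) ^ 4 / C₁ *
            |kerE (Matrix.specialUnitaryGroup (Fin 2) ℂ) (fundamentalLatticeRep 2) β (fun k => x i k - (R + 1)) (2 * R + 3) U
                (plane (Matrix.specialUnitaryGroup (Fin 2) ℂ) (fundamentalLatticeRep 2) (q i) (x i)) -
              kerE (Matrix.specialUnitaryGroup (Fin 2) ℂ) (fundamentalLatticeRep 2) β (fun k => x i k - (R + 1)) (2 * R + 3) 1
                (plane (Matrix.specialUnitaryGroup (Fin 2) ℂ) (fundamentalLatticeRep 2) (q i) (x i))|)) ≤ Real.exp (B * T.card) := by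
  letI : MeasurableSpace (Matrix.specialUnitaryGroup (Fin 2) ℂ) := borel _
  haveI : BorelSpace (Matrix.specialUnitaryGroup (Fin 2) ℂ) := ⟨rfl⟩
  obtain ⟨κ, β₀, ℓ₀, hκ, hℓ₀, hSCW⟩ := hSCW
  obtain ⟨C₁, B, β₁, ℓ₁, hC₁, hℓ₁, hXM⟩ := hXM
  refine ⟨C₁, B + 2 * κ / C₁, max β₀ β₁, min ℓ₀ ℓ₁, hC₁, lt_min hℓ₀ hℓ₁, ?_⟩
  intro β hβ L n q x R hq hR hRa hL hsep T
  have hβ0 : β₀ ≤ β := (le_max_left _ _).trans hβ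
  have hβ1 : β₁ ≤ β := (le_max_right _ _).trans hβ
  have hRa0 : (R : ℝ) * Transport.uRec β ≤ ℓ₀ := hRa.trans (min_le_left _ _)
  have hRa1 : (R : ℝ) * Transport.uRec β ≤ ℓ₁ := hRa.trans (min_le_right _ _)
  have hR0 : (0 : ℝ) < R := by exact_mod_cast (show 0 < R by omega)
  have hR4 : (0 : ℝ) < (R : ℝ) ^ 4 := by positivity
  -- cold-wall kernel means and kernels
  set K1 : Fin n → ℝ := fun i =>
    kerE (Matrix.specialUnitaryGroup (Fin 2) ℂ) (fundamentalLatticeRep 2) β (fun k => x i k - (R + 1)) (2 * R + 3) 1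
      (plane (Matrix.specialUnitaryGroup (Fin 2) ℂ) (fundamentalLatticeRep 2) (q i) (x i)) with hK1
  set k : Fin n → LGConfig 4 (Matrix.specialUnitaryGroup (Fin 2) ℂ) → ℝ := fun i U =>
    kerE (Matrix.specialUnitaryGroup (Fin 2) ℂ) (fundamentalLatticeRep 2) β (fun k => x i k - (R + 1)) (2 * R + 3) U
      (plane (Matrix.specialUnitaryGroup (Fin 2) ℂ) (fundamentalLatticeRep 2) (q i) (x i)) with hk
  have hkc : ∀ i, Continuous (k i) := fun i => continuous_kerE_plane rF β _ _ (q i) (x i)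
  -- pointwise slack inequality, per site
  have hmulκ : (R : ℝ) ^ 4 / C₁ * (2 * (κ / (R : ℝ) ^ 4)) = 2 * κ / C₁ := by
    field_simp
  have hpt : ∀ i U, (R : ℝ) ^ 4 / C₁ * |k i U - K1 i| ≤ (R : ℝ) ^ 4 / C₁ * (K1 i - k i U) + 2 * κ / C₁ := by
    intro i U
    have hs : k i U ≤ K1 i + κ / (R : ℝ) ^ 4 := hSCW β hβ0 R hR hRa0 (q i) (x i) (hq i) U
    have hκR : 0 ≤ κ / (R : ℝ) ^ 4 := div_nonneg hκ hR4.le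
    have habs : |k i U - K1 i| ≤ (K1 i - k i U) + 2 * (κ / (R : ℝ) ^ 4) := by
      rcases le_or_gt (k i U) (K1 i) with h | h
      · rw [abs_of_nonpos (sub_nonpos.2 h)]
        linarith
      · rw [abs_of_pos (sub_pos.2 h)]
        linarith
    have ha : 0 ≤ (R : ℝ) ^ 4 / C₁ := by positivity
    calc (R : ℝ) ^ 4 / C₁ * |k i U - K1 i|
        ≤ (R : ℝ) ^ 4 / C₁ * ((K1 i - k i U) + 2 * (κ / (R : ℝ) ^ 4)) := mul_le_mul_of_nonneg_left habs ha
      _ = (R : ℝ) ^ 4 / C₁ * (K1 i - k i U) + 2 * κ / C₁ := by rw [mul_add, hmulκ]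
  have hsum : ∀ U, ∑ i ∈ T, (R : ℝ) ^ 4 / C₁ * |k i U - K1 i| ≤
      ∑ i ∈ T, (R : ℝ) ^ 4 / C₁ * (K1 i - k i U) + 2 * κ / C₁ * T.card := by
    intro U
    calc ∑ i ∈ T, (R : ℝ) ^ 4 / C₁ * |k i U - K1 i|
        ≤ ∑ i ∈ T, ((R : ℝ) ^ 4 / C₁ * (K1 i - k i U) + 2 * κ / C₁) := Finset.sum_le_sum fun i _ => hpt i U
      _ = ∑ i ∈ T, (R : ℝ) ^ 4 / C₁ * (K1 i - k i U) + 2 * κ / C₁ * T.card := by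
          rw [Finset.sum_add_distrib, Finset.sum_const, nsmul_eq_mul]
          ring
  -- the two integrands
  have hA : Continuous (fun U : LGConfig 4 (Matrix.specialUnitaryGroup (Fin 2) ℂ) =>
      Real.exp (∑ i ∈ T, (R : ℝ) ^ 4 / C₁ * |k i U - K1 i|)) :=
    Real.continuous_exp.comp (continuous_finsetSum T fun i _ => continuous_const.mul ((hkc i).sub continuous_const).abs)
  have hB : Continuous (fun U : LGConfig 4 (Matrix.specialUnitaryGroup (Fin 2) ℂ) =>
      Real.exp (2 * κ / C₁ * T.card) * Real.exp (∑ i ∈ T, (R : ℝ) ^ 4 / C₁ * (K1 i - k i U))) :=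
    continuous_const.mul (Real.continuous_exp.comp (continuous_finsetSum T fun i _ => continuous_const.mul (continuous_const.sub (hkc i))))
  have hle : ∀ U : LGConfig 4 (Matrix.specialUnitaryGroup (Fin 2) ℂ),
      Real.exp (∑ i ∈ T, (R : ℝ) ^ 4 / C₁ * |k i U - K1 i|) ≤
        Real.exp (2 * κ / C₁ * T.card) * Real.exp (∑ i ∈ T, (R : ℝ) ^ 4 / C₁ * (K1 i - k i U)) := fun U => by
    calc Real.exp (∑ i ∈ T, (R : ℝ) ^ 4 / C₁ * |k i U - K1 i|)
        ≤ Real.exp (∑ i ∈ T, (R : ℝ) ^ 4 / C₁ * (K1 i - k i U) + 2 * κ / C₁ * T.card) := Real.exp_le_exp.2 (hsum U)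
      _ = Real.exp (2 * κ / C₁ * T.card) * Real.exp (∑ i ∈ T, (R : ℝ) ^ 4 / C₁ * (K1 i - k i U)) := by
          rw [Real.exp_add, mul_comm]
  have hX := hXM β hβ1 L n q x R hq hR hRa1 hL hsep T
  calc torusE (Matrix.specialUnitaryGroup (Fin 2) ℂ) rF β L (fun U => Real.exp (∑ i ∈ T, (R : ℝ) ^ 4 / C₁ * |k i U - K1 i|))
      ≤ torusE (Matrix.specialUnitaryGroup (Fin 2) ℂ) rF β L (fun U =>
          Real.exp (2 * κ / C₁ * T.card) * Real.exp (∑ i ∈ T, (R : ℝ) ^ 4 / C₁ * (K1 i - k i U))) := torusE_mono rF β L hA hB hle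
    _ = Real.exp (2 * κ / C₁ * T.card) *
          torusE (Matrix.specialUnitaryGroup (Fin 2) ℂ) rF β L (fun U => Real.exp (∑ i ∈ T, (R : ℝ) ^ 4 / C₁ * (K1 i - k i U))) :=
        torusE_const_mul' rF β L _ _
    _ ≤ Real.exp (2 * κ / C₁ * T.card) * Real.exp (B * T.card) := mul_le_mul_of_nonneg_left hX (Real.exp_pos _).le
    _ = Real.exp ((B + 2 * κ / C₁) * T.card) := by rw [← Real.exp_add]; ring_nf

/-- The derived reference values are bounded (a torus mean of a bounded continuous observable). -/
theorem abs_pRef_le (ℓ₁ : ℝ) : ∃ P₀ : ℝ, ∀ q β, |pRef ℓ₁ q β| ≤ P₀ := by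
  letI : MeasurableSpace (Matrix.specialUnitaryGroup (Fin 2) ℂ) := borel _
  haveI : BorelSpace (Matrix.specialUnitaryGroup (Fin 2) ℂ) := ⟨rfl⟩
  obtain ⟨CA, hCA⟩ := exists_abs_plane_le (G := Matrix.specialUnitaryGroup (Fin 2) ℂ) rF
  refine ⟨CA, fun q β => ?_⟩
  have h := abs_torusE_sub_le_of_forall rF β (Ldag ℓ₁ β) (continuous_plane rF q 0) (c := 0) (h := CA)
    (fun U => by rw [sub_zero]; exact hCA q 0 U)
  simpa [pRef, sub_zero] using h

/-- GLUE (proved here): the cold-wall-centred ABSOLUTE joint exponential moment bound ⇒ the registered v5(α) (RM) body, with the DERIVED reference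
`pRef ℓ₁`, unit `a := uRec`, `c := 1`, `B ↦ B + (e^B − 1)`.  Mechanism: `coldWall_pin_abs` moves the centre from `kerE^𝟙_i` to `pRef` at cost
`exp((e^B − 1)·#T)` (`ResponsePinning.torusE_exp_sum_response_recentre`). -/
theorem responseMomentsOdd6SU2_of_absMoments
    (hAM : letI : MeasurableSpace (Matrix.specialUnitaryGroup (Fin 2) ℂ) := borel _
      haveI : BorelSpace (Matrix.specialUnitaryGroup (Fin 2) ℂ) := ⟨rfl⟩
      ∃ (C₁ B β₁ ℓ₁ : ℝ), 0 < C₁ ∧ 0 < ℓ₁ ∧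
      ∀ β : ℝ, β₁ ≤ β → ∀ (L n : ℕ) (q : Fin n → Fin 4 × Fin 4) (x : Fin n → (Fin 4 → ℤ)) (R : ℕ),
      (∀ i, (q i).1 < (q i).2) → 1 ≤ R → (R : ℝ) * Transport.uRec β ≤ ℓ₁ → 4 * R + 8 ≤ L →
      (∀ i j : Fin n, i ≠ j → ∃ k : Fin 4,
        (2 * (R : ℤ) + 4) ≤ |((((x i k - x j k : ℤ) : ZMod (2 * L + 1))).valMinAbs : ℤ)|) →
      ∀ T : Finset (Fin n),
        torusE (Matrix.specialUnitaryGroup (Fin 2) ℂ) (fundamentalLatticeRep 2) β L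
          (fun U => Real.exp (∑ i ∈ T, (R : ℝ) ^ 4 / C₁ *
            |kerE (Matrix.specialUnitaryGroup (Fin 2) ℂ) (fundamentalLatticeRep 2) β (fun k => x i k - (R + 1)) (2 * R + 3) U
                (plane (Matrix.specialUnitaryGroup (Fin 2) ℂ) (fundamentalLatticeRep 2) (q i) (x i)) -
              kerE (Matrix.specialUnitaryGroup (Fin 2) ℂ) (fundamentalLatticeRep 2) β (fun k => x i k - (R + 1)) (2 * R + 3) 1
                (plane (Matrix.specialUnitaryGroup (Fin 2) ℂ) (fundamentalLatticeRep 2) (q i) (x i))|)) ≤ Real.exp (B * T.card)) :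
    letI : MeasurableSpace (Matrix.specialUnitaryGroup (Fin 2) ℂ) := borel _
    haveI : BorelSpace (Matrix.specialUnitaryGroup (Fin 2) ℂ) := ⟨rfl⟩
    ∃ (a : ℝ → ℝ) (c : ℝ) (C₁ B β₁ ℓ₁ P₀ : ℝ) (p : Fin 4 × Fin 4 → ℝ → ℝ), 0 < c ∧
      (∀ᶠ β in atTop, a β ≤ c * Transport.uRec β) ∧ 0 < ℓ₁ ∧ 0 < C₁ ∧ (∀ q β, |p q β| ≤ P₀) ∧
      ∀ β : ℝ, β₁ ≤ β → ∀ (L n : ℕ) (q : Fin n → Fin 4 × Fin 4) (x : Fin n → (Fin 4 → ℤ)) (R : ℕ),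
        (∀ i, (q i).1 < (q i).2) → 1 ≤ R → (R : ℝ) * a β ≤ ℓ₁ → 4 * R + 8 ≤ L →
        (∀ i j : Fin n, i ≠ j → ∃ k : Fin 4,
          (2 * (R : ℤ) + 4) ≤ |((((x i k - x j k : ℤ) : ZMod (2 * L + 1))).valMinAbs : ℤ)|) →
        ∀ T : Finset (Fin n),
          torusE (Matrix.specialUnitaryGroup (Fin 2) ℂ) (fundamentalLatticeRep 2) β L
            (fun U => Real.exp (∑ i ∈ T, (R : ℝ) ^ 4 / C₁ *
              |kerE (Matrix.specialUnitaryGroup (Fin 2) ℂ) (fundamentalLatticeRep 2) β (fun k => x i k - (R + 1)) (2 * R + 3) U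
                (plane (Matrix.specialUnitaryGroup (Fin 2) ℂ) (fundamentalLatticeRep 2) (q i) (x i)) - p (q i) β|)) ≤ Real.exp (B * T.card) := by
  letI : MeasurableSpace (Matrix.specialUnitaryGroup (Fin 2) ℂ) := borel _
  haveI : BorelSpace (Matrix.specialUnitaryGroup (Fin 2) ℂ) := ⟨rfl⟩
  obtain ⟨C₁, B, β₁, ℓ₁, hC₁, hℓ₁, hAM⟩ := hAM
  obtain ⟨P₀, hP₀⟩ := abs_pRef_le ℓ₁
  refine ⟨Transport.uRec, 1, C₁, B + (Real.exp B - 1), β₁, ℓ₁, P₀, pRef ℓ₁, one_pos,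
    Filter.Eventually.of_forall fun β => by rw [one_mul], hℓ₁, hC₁, hP₀, ?_⟩
  intro β hβ L n q x R hq hR hRa hL hsep T
  have hR0 : (0 : ℝ) < R := by exact_mod_cast (show 0 < R by omega)
  -- cold-wall kernel means (the deterministic centring)
  set K1 : Fin n → ℝ := fun i =>
    kerE (Matrix.specialUnitaryGroup (Fin 2) ℂ) (fundamentalLatticeRep 2) β (fun k => x i k - (R + 1)) (2 * R + 3) 1
      (plane (Matrix.specialUnitaryGroup (Fin 2) ℂ) (fundamentalLatticeRep 2) (q i) (x i)) with hK1
  have hmom : torusE (Matrix.specialUnitaryGroup (Fin 2) ℂ) (fundamentalLatticeRep 2) β L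
      (fun U => Real.exp (∑ i ∈ T, (R : ℝ) ^ 4 / C₁ *
        |kerE (Matrix.specialUnitaryGroup (Fin 2) ℂ) (fundamentalLatticeRep 2) β (fun k => x i k - (R + 1)) (2 * R + 3) U
            (plane (Matrix.specialUnitaryGroup (Fin 2) ℂ) (fundamentalLatticeRep 2) (q i) (x i)) - K1 i|)) ≤ Real.exp (B * T.card) :=
    hAM β hβ L n q x R hq hR hRa hL hsep T
  -- pinning of the derived reference to each cold-wall mean (one-site case on the canonical torus)
  have hpin : ∀ i ∈ T, |K1 i - pRef ℓ₁ (q i) β| ≤ C₁ * (Real.exp B - 1) / (R : ℝ) ^ 4 := by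
    intro i _
    have h1 := hAM β hβ (Ldag ℓ₁ β) 1 (fun _ => q i) (fun _ => x i) R (fun _ => hq i) hR hRa (le_Ldag hRa)
      (fun i' j' hij => absurd (Subsingleton.elim i' j') hij) Finset.univ
    simp only [Finset.univ_unique, Finset.sum_singleton, Finset.card_singleton, Nat.cast_one, mul_one] at h1
    exact coldWall_pin_abs hC₁ hR hRa (q i) (x i) h1
  -- recentre
  have hrec := torusE_exp_sum_response_recentre rF β L T q x R hC₁ K1 (fun i => pRef ℓ₁ (q i) β) hpin
  refine hrec.trans ?_
  have hfac : Real.exp ((R : ℝ) ^ 4 / C₁ * (C₁ * (Real.exp B - 1) / (R : ℝ) ^ 4) * T.card) = Real.exp ((Real.exp B - 1) * T.card) := by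
    congr 1
    field_simp
  rw [hfac]
  calc Real.exp ((Real.exp B - 1) * T.card) * torusE (Matrix.specialUnitaryGroup (Fin 2) ℂ) rF β L
        (fun U => Real.exp (∑ i ∈ T, (R : ℝ) ^ 4 / C₁ *
          |kerE (Matrix.specialUnitaryGroup (Fin 2) ℂ) rF β (fun k => x i k - (R + 1)) (2 * R + 3) U
              (plane (Matrix.specialUnitaryGroup (Fin 2) ℂ) rF (q i) (x i)) - K1 i|))
      ≤ Real.exp ((Real.exp B - 1) * T.card) * Real.exp (B * T.card) :=
        mul_le_mul_of_nonneg_left hmom (Real.exp_pos _).le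
    _ = Real.exp ((B + (Real.exp B - 1)) * T.card) := by rw [← Real.exp_add]; ring_nf

/-- (RM) — a THEOREM of the skeleton: the registered v5(α) text of `stub_responseMomentsOdd6` VERBATIM (`UV →` kept because it is the registered text;
the hypothesis is not consumed), from (SCW) ∧ (XM) through `absMoments_of_slack` and `responseMomentsOdd6SU2_of_absMoments`. -/
theorem stub_responseMomentsOdd6 :
    Summit.QuantumFields.YangMills.Theses.BalabanLadder.UV →
      letI : MeasurableSpace (Matrix.specialUnitaryGroup (Fin 2) ℂ) := borel _
      haveI : BorelSpace (Matrix.specialUnitaryGroup (Fin 2) ℂ) := ⟨rfl⟩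
      ∃ (a : ℝ → ℝ) (c : ℝ) (C₁ B β₁ ℓ₁ P₀ : ℝ) (p : Fin 4 × Fin 4 → ℝ → ℝ), 0 < c ∧
      (∀ᶠ β in atTop, a β ≤ c * Transport.uRec β) ∧ 0 < ℓ₁ ∧ 0 < C₁ ∧ (∀ q β, |p q β| ≤ P₀) ∧
      ∀ β : ℝ, β₁ ≤ β → ∀ (L n : ℕ) (q : Fin n → Fin 4 × Fin 4) (x : Fin n → (Fin 4 → ℤ)) (R : ℕ),
      (∀ i, (q i).1 < (q i).2) → 1 ≤ R → (R : ℝ) * a β ≤ ℓ₁ → 4 * R + 8 ≤ L →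
      (∀ i j : Fin n, i ≠ j → ∃ k : Fin 4,
      (2 * (R : ℤ) + 4) ≤ |((((x i k - x j k : ℤ) : ZMod (2 * L + 1))).valMinAbs : ℤ)|) →
      ∀ T : Finset (Fin n),
      torusE (Matrix.specialUnitaryGroup (Fin 2) ℂ) (Literature.MathematicalPhysics.QuantumLattice.fundamentalLatticeRep 2) β L
      (fun U => Real.exp (∑ i ∈ T, (R : ℝ) ^ 4 / C₁ *
      |kerE (Matrix.specialUnitaryGroup (Fin 2) ℂ) (Literature.MathematicalPhysics.QuantumLattice.fundamentalLatticeRep 2) β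
      (fun k => x i k - (R + 1)) (2 * R + 3) U
      (plane (Matrix.specialUnitaryGroup (Fin 2) ℂ) (Literature.MathematicalPhysics.QuantumLattice.fundamentalLatticeRep 2) (q i) (x i)) -
      p (q i) β|)) ≤ Real.exp (B * T.card) :=
  fun _ => responseMomentsOdd6SU2_of_absMoments (absMoments_of_slack stub_slackColdWall stub_defectMoments)

/-- E0′ ceilings — a THEOREM of the skeleton (as v5(α)): (RM) through the landed press-button `TemperedResponse.stubCeilings_of_responseMoments`
(p532738).  Statement = v4-F's `stub_ceilings` VERBATIM. -/
theorem stub_ceilings :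
    Summit.QuantumFields.YangMills.Theses.BalabanLadder.UV →
      letI : MeasurableSpace (Matrix.specialUnitaryGroup (Fin 2) ℂ) := borel _
      haveI : BorelSpace (Matrix.specialUnitaryGroup (Fin 2) ℂ) := ⟨rfl⟩
      MomentBounds6 (Matrix.specialUnitaryGroup (Fin 2) ℂ) rF uRec :=
  fun hUV => Summit.QuantumFields.YangMills.Cruxes.UVSeamRec.TemperedResponse.stubCeilings_of_responseMoments
    (stub_responseMomentsOdd6 hUV)

/-- STUB F-B∧F-C «compact-witness floors at an asymptotically-two-loop engine unit» (XL; NO `UV`; BYTE-IDENTICAL to v5(α)/v7c/v8c/v8d/coldwall_pure/extremal_coldwall; = the engine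
data of the landed per-representation transfer `UnitTransfer.lowerBounds_uRec_of_engine rF`, p441552): the FUNDAMENTAL representation `rF` of `SU(2)` and
a unit map `a` with `a β / uRec β → c₀ > 0` carrying the `Q2`/`Q3` floors with COMPACTLY SUPPORTED witnesses.  Supplier: the NT line's conditional femto
package at `SU(2)`-fundamental (19353 `stub_cfp : CFP` engine E1–E3; landed discharge `FloorsEngineOfWindow.floorsEngine_of_fcp_commensurable rF a …`,
p448741).  NOT rescued by this line (its rescue is a line on 19353).  Why it might fail: as NT (19353) — a β-uniform floor is dimensional transmutation
(barrier PerturbativeInvisibility) — plus the scaling of the non-perturbative unit (Patrascioiu–Seiler vs. consensus). -/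
theorem stub_floorsEngine :
    letI : MeasurableSpace (Matrix.specialUnitaryGroup (Fin 2) ℂ) := borel _
    haveI : BorelSpace (Matrix.specialUnitaryGroup (Fin 2) ℂ) := ⟨rfl⟩
    ∃ (a : ℝ → ℝ) (c₀ : ℝ), 0 < c₀ ∧ (∀ β, 0 < a β) ∧
      Tendsto (fun β => a β / uRec β) atTop (𝓝 c₀) ∧
      (∃ (v : 𝓢(EuclideanSpace ℝ (Fin 4), ℝ)) (ε β₅ Λ₅ : ℝ),
        HasCompactSupport (v : EuclideanSpace ℝ (Fin 4) → ℝ) ∧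
        tsupport (v : EuclideanSpace ℝ (Fin 4) → ℝ) ⊆ {y : EuclideanSpace ℝ (Fin 4) | 0 < y 0} ∧ 0 < ε ∧
        ∀ β : ℝ, β₅ ≤ β → ∀ L : ℕ, Λ₅ ≤ a β * L →
          ε ≤ Q2 (Matrix.specialUnitaryGroup (Fin 2) ℂ) rF β L (a β) (thetaTest 4 v) v) ∧
      (∃ (f g h : 𝓢(EuclideanSpace ℝ (Fin 4), ℝ)) (ε β₅ Λ₅ : ℝ),
        HasCompactSupport (f : EuclideanSpace ℝ (Fin 4) → ℝ) ∧
        HasCompactSupport (g : EuclideanSpace ℝ (Fin 4) → ℝ) ∧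
        HasCompactSupport (h : EuclideanSpace ℝ (Fin 4) → ℝ) ∧
        Disjoint (tsupport (f : EuclideanSpace ℝ (Fin 4) → ℝ)) (tsupport (g : EuclideanSpace ℝ (Fin 4) → ℝ)) ∧
        Disjoint (tsupport (g : EuclideanSpace ℝ (Fin 4) → ℝ)) (tsupport (h : EuclideanSpace ℝ (Fin 4) → ℝ)) ∧
        Disjoint (tsupport (f : EuclideanSpace ℝ (Fin 4) → ℝ)) (tsupport (h : EuclideanSpace ℝ (Fin 4) → ℝ)) ∧
        0 < ε ∧ ∀ β : ℝ, β₅ ≤ β → ∀ L : ℕ, Λ₅ ≤ a β * L →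
          ε ≤ |Q3 (Matrix.specialUnitaryGroup (Fin 2) ℂ) rF β L (a β) f g h|) := by
  sorry

/-- COMPOSITION (kernel-checked, closed form): ceilings ⊕ engine floors ⊕ LANDED unit transfer ⊕ transport ⇒ the item BY NAME. -/
theorem UVSeamRec_of : Summit.QuantumFields.YangMills.Theses.BalabanLadder.UVSeamRec := by
  intro hUV G _ _ _ _ hG hcl
  letI : MeasurableSpace (Matrix.specialUnitaryGroup (Fin 2) ℂ) := borel _
  haveI : BorelSpace (Matrix.specialUnitaryGroup (Fin 2) ℂ) := ⟨rfl⟩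
  have hc := stub_ceilings hUV
  obtain ⟨a, c₀, hc₀, ha, hau, h2, h3⟩ := stub_floorsEngine
  have hlb := Summit.QuantumFields.YangMills.Cruxes.UVSeamRec.UnitTransfer.lowerBounds_uRec_of_engine rF hc₀ ha hau hc h2 h3
  exact stub_transport ⟨rF, hlb, hc⟩ G hG hcl

end Summit.QuantumFields.YangMills.Cruxes.UVSeamRec.SlackColdWall
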